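import Mathlib.Algebra.Group.Pi.Lemmas
import Mathlib.Algebra.Group.Submonoid.Operations
import Mathlib.Algebra.Order.Field.Basic
import Mathlib.Algebra.Order.Field.Rat
import Mathlib.Data.NNRat.Lemmas
import Mathlib.Data.NNRat.Order
import Mathlib.Algebra.BigOperators.Group.Finset.Piecewise
import Mathlib.Algebra.Order.BigOperators.GroupWithZero.Finset
import Literature.AlgebraicGeometry.Frobenioids.Monoids
import Literature.AlgebraicGeometry.Frobenioids.MonoidFunctors
import Literature.AlgebraicGeometry.Frobenioids.PerfectionDivisorial
import HarnessLib

/-!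
# The perfection of a free commutative monoid `∏_I ℤ_{≥0}`: the bounded-denominator product
# ([EtTh] Prop. 3.2 (i), the "direct product of copies of `ℚ_{≥0}`")

Mochizuki, *The étale theta function …*, Publ. RIMS **45** (2009), Prop. 3.2 (i), PDF p. 70
(printed 296) [cite: MochizukiEtTh2009, Prop 3.2 (i) p.70]: "`DIV⁺(Z^log_∞)^pf` may be naturally
identified with a direct product of copies of `ℚ_{≥0}`, indexed by the cusps and irreducible
components of the special fiber of `Z^log_∞`".  By Def. 3.1 (i) (p. 70) `DIV⁺(Z^log_∞)` is the
monoid of effective divisors supported in the special fibre and the cusps, i.e. (the special fibre of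
`Z_∞` being only locally of finite type, divisors are locally finite sums) the full product
`∏_I ℤ_{≥0}` over that index set `I`; for the curves of [EtTh] (dual graph with a loop, e.g. the Tate
curve, Ex. 3.9) `Z_∞ → Z` is an infinite covering and `I` is infinite.

This file computes the printed "natural identification" for an ARBITRARY index set (perfection
`M^pf` in the sense of [FrdI] §0 = `Literature.AlgebraicGeometry.Frobenioids.Perfection`, monoids
written multiplicatively as there, `ℚ_{≥0}` as `Multiplicative ℚ≥0`):

* `funPerfectionHom` : the natural map `(∏_I ℤ_{≥0})^pf → ∏_I ℚ_{≥0}`, `a^{1/n} ↦ (a_i / n)_i`, is an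
  injective homomorphism (`funPerfectionHom_injective`) whose image is EXACTLY `boundedDenom I`, the
  submonoid of functions admitting a common denominator (`mrange_funPerfectionHom`); packaged as
  `funPerfectionEquiv : (∏_I ℤ_{≥0})^pf ≃* boundedDenom I`;
* for FINITE `I` the image is the whole product (`boundedDenom_eq_top`, `funPerfectionEquivOfFinite`)
  — the case in which the literal reading of Prop. 3.2 (i) is an isomorphism;
* divisibility in `boundedDenom I` is the pointwise order (`boundedDenom_dvd_iff`), and the elements
  `bdSingle`, `bdUpdate` used in `FreeMonoidPerfectionRigidity.lean` to show that for infinite `I`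
  NO isomorphism `(∏_I ℤ_{≥0})^pf ≅ ∏_J ℚ_{≥0}` exists.

Classical monoid algebra; no side is taken on anything in [IUTchIII]. Seat abc-iut-L2-t6 (L2-lead
pool item EtTh:Prop3.2(i); settles abc-iut-L6-t23's question on `LogDivisorModel.perfectionEquiv`).
-/

noncomputable section

namespace Literature.AnabelianGeometry.EtaleTheta

open Function Literature.AlgebraicGeometry.Frobenioids Multiplicative

universe u


/-! ### The bounded-denominator product and the perfection of `∏_I ℤ_{≥0}` -/

section FunPerfection

variable (I : Type u)

/-- The submonoid of `∏_I ℚ_{≥0}` (multiplicative notation) of functions admitting a common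
denominator: `f` such that `N · f ∈ ∏_I ℤ_{≥0}` for some `N ≥ 1`. This — not the full product when
`I` is infinite — is the image of the natural identification of Prop. 3.2 (i).
[cite: MochizukiEtTh2009, Prop 3.2 (i) p.70] -/
def boundedDenom : Submonoid (I → Multiplicative ℚ≥0) where
  carrier := {f | ∃ N : ℕ+, ∀ i, ∃ m : ℕ, toAdd (f i) = (m : ℚ≥0) / (N : ℕ)}
  one_mem' := ⟨1, fun _ => ⟨0, by simp⟩⟩
  mul_mem' := by
    rintro f g ⟨N, hN⟩ ⟨N', hN'⟩
    refine ⟨N * N', fun i => ?_⟩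
    obtain ⟨m, hm⟩ := hN i
    obtain ⟨m', hm'⟩ := hN' i
    refine ⟨m * N' + N * m', ?_⟩
    rw [Pi.mul_apply, toAdd_mul, hm, hm', PNat.mul_coe,
      div_add_div _ _ (Nat.cast_ne_zero.mpr N.pos.ne') (Nat.cast_ne_zero.mpr N'.pos.ne')]
    push_cast
    ring

/-- Membership in `boundedDenom I`. [cite: MochizukiEtTh2009, Prop 3.2 (i) p.70] -/
theorem mem_boundedDenom_iff {f : I → Multiplicative ℚ≥0} :
    f ∈ boundedDenom I ↔ ∃ N : ℕ+, ∀ i, ∃ m : ℕ, toAdd (f i) = (m : ℚ≥0) / (N : ℕ) := Iff.rfl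

/-- The value `(a_i / n)_i ∈ ∏_I ℚ_{≥0}` of the class `a^{1/n}` of `(∏_I ℤ_{≥0})^pf`.
[cite: MochizukiEtTh2009, Prop 3.2 (i) p.70] -/
def funPerfectionVal (x : (I → Multiplicative ℕ) × ℕ+) : I → Multiplicative ℚ≥0 :=
  fun i => ofAdd (((toAdd (x.1 i) : ℕ) : ℚ≥0) / (x.2 : ℕ))

/-- `funPerfectionVal` respects the relation defining the perfection. [cite: MochizukiEtTh2009, Prop 3.2 (i) p.70] -/
theorem funPerfectionVal_wd (x y : (I → Multiplicative ℕ) × ℕ+)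
    (h : PerfectionRel (I → Multiplicative ℕ) x y) : funPerfectionVal I x = funPerfectionVal I y := by
  obtain ⟨K, hK⟩ := h
  funext i
  have hK' : (K : ℕ) * (y.2 : ℕ) * (toAdd (x.1 i) : ℕ) = (K : ℕ) * (x.2 : ℕ) * (toAdd (y.1 i) : ℕ) := by
    have := congrArg (fun z : I → Multiplicative ℕ => (toAdd (z i) : ℕ)) hK
    simpa only [Pi.pow_apply, toAdd_pow, smul_eq_mul] using this
  have h2 : (y.2 : ℕ) * (toAdd (x.1 i) : ℕ) = (x.2 : ℕ) * (toAdd (y.1 i) : ℕ) := by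
    rw [mul_assoc, mul_assoc] at hK'
    exact Nat.eq_of_mul_eq_mul_left K.pos hK'
  unfold funPerfectionVal
  congr 1
  rw [div_eq_div_iff (Nat.cast_ne_zero.mpr x.2.pos.ne') (Nat.cast_ne_zero.mpr y.2.pos.ne'),
    mul_comm, ← Nat.cast_mul, h2, Nat.cast_mul, mul_comm]

/-- **The natural map `(∏_I ℤ_{≥0})^pf → ∏_I ℚ_{≥0}`**, `a^{1/n} ↦ (a_i/n)_i` — the "natural
identification" of Prop. 3.2 (i). [cite: MochizukiEtTh2009, Prop 3.2 (i) p.70] -/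
def funPerfectionHom : Perfection (I → Multiplicative ℕ) →* (I → Multiplicative ℚ≥0) where
  toFun := Quotient.lift (funPerfectionVal I) (funPerfectionVal_wd I)
  map_one' := by
    show funPerfectionVal I (1, 1) = 1
    funext i
    simp [funPerfectionVal]
  map_mul' x y := by
    obtain ⟨⟨a, n⟩, rfl⟩ := Perfection.mk_surjective x
    obtain ⟨⟨b, m⟩, rfl⟩ := Perfection.mk_surjective y
    show funPerfectionVal I (a ^ (m : ℕ) * b ^ (n : ℕ), n * m) =
      funPerfectionVal I (a, n) * funPerfectionVal I (b, m)
    funext i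
    unfold funPerfectionVal
    rw [Pi.mul_apply, ← ofAdd_add]
    congr 1
    dsimp only
    rw [Pi.mul_apply, Pi.pow_apply, Pi.pow_apply, toAdd_mul, toAdd_pow, toAdd_pow, smul_eq_mul,
      smul_eq_mul, PNat.mul_coe, Nat.cast_add, Nat.cast_mul, Nat.cast_mul, Nat.cast_mul,
      div_add_div _ _ (Nat.cast_ne_zero.mpr n.pos.ne') (Nat.cast_ne_zero.mpr m.pos.ne')]
    congr 1
    ring

/-- `funPerfectionHom` on classes. [cite: MochizukiEtTh2009, Prop 3.2 (i) p.70] -/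
theorem funPerfectionHom_mk (a : I → Multiplicative ℕ) (n : ℕ+) :
    funPerfectionHom I (Perfection.mk a n) = fun i => ofAdd (((toAdd (a i) : ℕ) : ℚ≥0) / (n : ℕ)) :=
  rfl

/-- `funPerfectionHom` on classes, pointwise. [cite: MochizukiEtTh2009, Prop 3.2 (i) p.70] -/
theorem toAdd_funPerfectionHom_mk (a : I → Multiplicative ℕ) (n : ℕ+) (i : I) :
    toAdd (funPerfectionHom I (Perfection.mk a n) i) = ((toAdd (a i) : ℕ) : ℚ≥0) / (n : ℕ) :=
  rfl

/-- The natural map `(∏_I ℤ_{≥0})^pf → ∏_I ℚ_{≥0}` is injective. [cite: MochizukiEtTh2009, Prop 3.2 (i) p.70] -/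
theorem funPerfectionHom_injective : Injective (funPerfectionHom I) := by
  intro x y hxy
  obtain ⟨⟨a, n⟩, rfl⟩ := Perfection.mk_surjective x
  obtain ⟨⟨b, m⟩, rfl⟩ := Perfection.mk_surjective y
  dsimp only at hxy ⊢
  refine Perfection.mk_eq_mk_iff.mpr ⟨1, ?_⟩
  funext i
  have h := congrArg toAdd (congrFun hxy i)
  rw [toAdd_funPerfectionHom_mk, toAdd_funPerfectionHom_mk,
    div_eq_div_iff (Nat.cast_ne_zero.mpr n.pos.ne') (Nat.cast_ne_zero.mpr m.pos.ne'),
    ← Nat.cast_mul, ← Nat.cast_mul, Nat.cast_inj] at h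
  apply toAdd.injective
  rw [Pi.pow_apply, Pi.pow_apply, toAdd_pow, toAdd_pow, smul_eq_mul, smul_eq_mul, PNat.one_coe,
    one_mul, one_mul, mul_comm (m : ℕ), mul_comm (n : ℕ)]
  exact h

/-- **The image of the natural map is the bounded-denominator product.**
[cite: MochizukiEtTh2009, Prop 3.2 (i) p.70] -/
theorem mrange_funPerfectionHom : MonoidHom.mrange (funPerfectionHom I) = boundedDenom I := by
  ext f
  constructor
  · rintro ⟨x, rfl⟩
    obtain ⟨⟨a, n⟩, rfl⟩ := Perfection.mk_surjective x
    exact ⟨n, fun i => ⟨toAdd (a i), rfl⟩⟩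
  · rintro ⟨N, hN⟩
    choose m hm using hN
    refine ⟨Perfection.mk (fun i => ofAdd (m i)) N, funext fun i => ?_⟩
    apply toAdd.injective
    rw [toAdd_funPerfectionHom_mk, toAdd_ofAdd, hm i]

/-- Every value of the natural map has a common denominator. [cite: MochizukiEtTh2009, Prop 3.2 (i) p.70] -/
theorem funPerfectionHom_mem (x : Perfection (I → Multiplicative ℕ)) :
    funPerfectionHom I x ∈ boundedDenom I := by
  rw [← mrange_funPerfectionHom]
  exact ⟨x, rfl⟩

/-- **`(∏_I ℤ_{≥0})^pf ≅ boundedDenom I`** — the faithful form of the identification of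
Prop. 3.2 (i) for an arbitrary index set. [cite: MochizukiEtTh2009, Prop 3.2 (i) p.70] -/
def funPerfectionEquiv : Perfection (I → Multiplicative ℕ) ≃* boundedDenom I :=
  MulEquiv.ofBijective ((funPerfectionHom I).codRestrict (boundedDenom I) (funPerfectionHom_mem I))
    ⟨fun x y h => funPerfectionHom_injective I (congrArg Subtype.val h), fun f => by
      obtain ⟨x, hx⟩ := (mrange_funPerfectionHom I).ge f.2
      exact ⟨x, Subtype.ext hx⟩⟩

/-- `funPerfectionEquiv` is the natural map. [cite: MochizukiEtTh2009, Prop 3.2 (i) p.70] -/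
@[simp] theorem coe_funPerfectionEquiv (x : Perfection (I → Multiplicative ℕ)) :
    (funPerfectionEquiv I x : I → Multiplicative ℚ≥0) = funPerfectionHom I x := rfl

/-- For FINITE `I` every element of `∏_I ℚ_{≥0}` has a common denominator.
[cite: MochizukiEtTh2009, Prop 3.2 (i) p.70] -/
theorem boundedDenom_eq_top [Finite I] : boundedDenom I = ⊤ := by
  classical
  haveI := Fintype.ofFinite I
  refine top_le_iff.mp fun f _ => ?_
  refine ⟨⟨∏ i, (toAdd (f i)).den, Finset.prod_pos fun i _ => (toAdd (f i)).den_pos⟩, fun i => ?_⟩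
  have hdvd : (toAdd (f i)).den ∣ ∏ i, (toAdd (f i)).den := Finset.dvd_prod_of_mem _ (Finset.mem_univ i)
  have hpos : 0 < ∏ i, (toAdd (f i)).den := Finset.prod_pos fun i _ => (toAdd (f i)).den_pos
  obtain ⟨c, hc⟩ := hdvd
  have hc0 : c ≠ 0 := fun h => by rw [hc, h, mul_zero] at hpos; exact lt_irrefl 0 hpos
  refine ⟨(toAdd (f i)).num * c, ?_⟩
  rw [PNat.mk_coe, hc, Nat.cast_mul, Nat.cast_mul, mul_div_mul_right _ _ (Nat.cast_ne_zero.mpr hc0),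
    NNRat.num_div_den]

/-- For finite `I` the natural map IS an isomorphism onto the full product `∏_I ℚ_{≥0}` — the
case in which the literal reading of Prop. 3.2 (i) is correct. [cite: MochizukiEtTh2009, Prop 3.2 (i) p.70] -/
def funPerfectionEquivOfFinite [Finite I] :
    Perfection (I → Multiplicative ℕ) ≃* (I → Multiplicative ℚ≥0) :=
  (funPerfectionEquiv I).trans ((MulEquiv.submonoidCongr (boundedDenom_eq_top I)).trans
    Submonoid.topEquiv)

/-- Divisibility in `boundedDenom I` is the pointwise order. [cite: MochizukiEtTh2009, Prop 3.2 (i) p.70] -/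
theorem boundedDenom_dvd_iff {f g : boundedDenom I} :
    f ∣ g ↔ ∀ i, toAdd ((f : I → Multiplicative ℚ≥0) i) ≤ toAdd ((g : I → Multiplicative ℚ≥0) i) := by
  constructor
  · rintro ⟨c, hc⟩ i
    have := congrArg (fun h : boundedDenom I => toAdd ((h : I → Multiplicative ℚ≥0) i)) hc
    simp only [Submonoid.coe_mul, Pi.mul_apply, toAdd_mul] at this
    rw [this]
    exact le_self_add
  · intro h
    obtain ⟨N, hN⟩ := f.2
    obtain ⟨N', hN'⟩ := g.2
    have hmem : (fun i => ofAdd (toAdd ((g : I → Multiplicative ℚ≥0) i) -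
        toAdd ((f : I → Multiplicative ℚ≥0) i))) ∈ boundedDenom I := by
      refine ⟨N * N', fun i => ?_⟩
      obtain ⟨m, hm⟩ := hN i
      obtain ⟨m', hm'⟩ := hN' i
      have hle : m * (N' : ℕ) ≤ m' * (N : ℕ) := by
        have := h i
        rw [hm, hm', div_le_div_iff₀ (Nat.cast_pos.mpr N.pos) (Nat.cast_pos.mpr N'.pos)] at this
        exact_mod_cast this
      refine ⟨m' * N - m * N', ?_⟩
      rw [toAdd_ofAdd]
      -- both sides become `m'/N'` after adding `m/N`
      refine add_right_cancel (b := toAdd ((f : I → Multiplicative ℚ≥0) i)) ?_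
      rw [tsub_add_cancel_of_le (h i), hm, hm', PNat.mul_coe, Nat.cast_mul,
        div_add_div _ _ (mul_ne_zero (Nat.cast_ne_zero.mpr N.pos.ne') (Nat.cast_ne_zero.mpr N'.pos.ne'))
          (Nat.cast_ne_zero.mpr N.pos.ne'),
        div_eq_div_iff (Nat.cast_ne_zero.mpr N'.pos.ne')
          (mul_ne_zero (mul_ne_zero (Nat.cast_ne_zero.mpr N.pos.ne') (Nat.cast_ne_zero.mpr N'.pos.ne'))
            (Nat.cast_ne_zero.mpr N.pos.ne'))]
      have hnat : (m' * N - m * N') + m * (N' : ℕ) = m' * (N : ℕ) := Nat.sub_add_cancel hle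
      have hq : ((m' * N - m * N' : ℕ) : ℚ≥0) + (m : ℚ≥0) * (N' : ℕ) = (m' : ℚ≥0) * (N : ℕ) := by
        exact_mod_cast hnat
      calc (m' : ℚ≥0) * (((N : ℕ) : ℚ≥0) * (N' : ℕ) * (N : ℕ))
          = ((m' : ℚ≥0) * (N : ℕ)) * ((N : ℕ) * (N' : ℕ)) := by ring
        _ = (((m' * N - m * N' : ℕ) : ℚ≥0) + (m : ℚ≥0) * (N' : ℕ)) * ((N : ℕ) * (N' : ℕ)) := by rw [hq]
        _ = (((m' * N - m * N' : ℕ) : ℚ≥0) * (N : ℕ) + ((N : ℕ) : ℚ≥0) * (N' : ℕ) * (m : ℚ≥0)) * (N' : ℕ) := by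
            ring
    refine ⟨⟨_, hmem⟩, Subtype.ext (funext fun i => ?_)⟩
    apply toAdd.injective
    simp only [Submonoid.coe_mul, Pi.mul_apply, toAdd_mul, toAdd_ofAdd]
    rw [add_tsub_cancel_of_le (h i)]

variable [DecidableEq I]

/-- The element `q · e_i` (value `q` at `i`, `0` elsewhere) of `boundedDenom I`.
[cite: MochizukiEtTh2009, Prop 3.2 (i) p.70] -/
def bdSingle (i : I) (q : ℚ≥0) : boundedDenom I :=
  ⟨Pi.mulSingle i (ofAdd q), ⟨⟨q.den, q.den_pos⟩, fun i' => by
    by_cases h : i' = i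
    · subst h; exact ⟨q.num, by rw [Pi.mulSingle_eq_same, toAdd_ofAdd, PNat.mk_coe, NNRat.num_div_den]⟩
    · exact ⟨0, by rw [Pi.mulSingle_eq_of_ne h]; simp⟩⟩⟩

/-- Modify one value of an element of `boundedDenom I`. [cite: MochizukiEtTh2009, Prop 3.2 (i) p.70] -/
def bdUpdate (z : boundedDenom I) (i : I) (q : ℚ≥0) : boundedDenom I :=
  ⟨Function.update (z : I → Multiplicative ℚ≥0) i (ofAdd q), by
    obtain ⟨N, hN⟩ := z.2
    refine ⟨N * ⟨q.den, q.den_pos⟩, fun i' => ?_⟩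
    by_cases h : i' = i
    · subst h
      refine ⟨q.num * N, ?_⟩
      rw [Function.update_self, toAdd_ofAdd, PNat.mul_coe, PNat.mk_coe, Nat.cast_mul, Nat.cast_mul,
        mul_comm (N : ℚ≥0), mul_div_mul_right _ _ (Nat.cast_ne_zero.mpr N.pos.ne'), NNRat.num_div_den]
    · obtain ⟨m, hm⟩ := hN i'
      refine ⟨m * q.den, ?_⟩
      rw [Function.update_of_ne h, hm, PNat.mul_coe, PNat.mk_coe, Nat.cast_mul, Nat.cast_mul,
        mul_div_mul_right _ _ (Nat.cast_ne_zero.mpr q.den_pos.ne')]⟩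

end FunPerfection

end Literature.AnabelianGeometry.EtaleTheta

end
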